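import Mathlib.MeasureTheory.Constructions.HaarToSphere
import Mathlib.MeasureTheory.Measure.Haar.InnerProductSpace
import Mathlib.Analysis.InnerProductSpace.PiL2
import Literature.MathematicalPhysics.KineticTheory.HardSphereEuler
import Literature.MathematicalPhysics.KineticTheory.Hilbert6Wave0
import Literature.Analysis.FluidPDE.CollisionCylinder
import HarnessLib

/-!
# `InformationPercolationEngine.KickFairRelEquilibrium` (stmt-AtomisticToContinuum-14914): the flux
# law on `S²` of a uniform impact parameter on the disc

Helper file (`--supports stmt-AtomisticToContinuum-14914`) of the line `Sketch` (card
`affine-fibre-statics`): its first lemma L1, the kinetic identity behind "the equilibrium kick kernel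
is the flux mean". If the impact parameter `b` is Lebesgue-uniform on the unit disc transverse to the
relative velocity direction `e₃`, the contact vector `ω(b) = (b₀, b₁, -√(1 - |b|²))` (incoming, lower
hemisphere) has law `(-ω₂)₊ dσ(ω)` on `S²`:

  `∫_{S²} G(ω) (-ω₂)₊ dσ(ω) = ∫_{|b| < 1} G(b₀, b₁, -√(1 - |b|²)) db`

for every bounded measurable `G : ℝ³ → ℝ` (`integral_flux_eq_integral_disc`; `σ = sphereMeasure` is
Mathlib's `volume.toSphere`, total mass `4π`; coordinates are indexed by `Fin 3`, so `ω₂ = ω 2` is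
the third one).

Proof. The collision cylinder formula `Literature.Analysis.FluidPDE.lintegral_collisionCylinder`
(Cercignani–Illner–Pulvirenti 1994, App. 4.A p. 108: `dx = ε^{d-1} |v · n| dσ(n) dτ`) with `ε = 1`,
`u = -e₃`, tested against `g(x) = 1_{[-3,-2]}(x₂) · 1_{|πx| < 1} F(ω(πx))`, `πx = (x₀, x₁)`:
on the sphere side the flight-time integral of the slab indicator is exactly `1` and
`ω(π(ν - τ e₃)) = ν` on the lower hemisphere, so the inner integral is `F(ν) (-ν₂)₊`; on the bulk
side `g` is supported in the collision cylinder and Fubini in `ℝ³ ≅ ℝ × ℝ²`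
(`volume_preserving_piFinSuccAbove`, `PiLp.volume_preserving_toLp`) gives `1 · ∫_{|b|<1} F(ω(b)) db`
(`KickFairRelEquilibriumFluxDisc.lintegral_flux_eq_lintegral_disc`, every measurable `F ≥ 0`). The
Bochner version follows by splitting `G` into `G₊ - G₋`.

References: C. Cercignani, R. Illner, M. Pulvirenti, *The Mathematical Theory of Dilute Gases*,
Springer (1994), §4.3 and App. 4.A p. 108.
-/

noncomputable section

open MeasureTheory Set Filter Topology
open scoped ENNReal Classical InnerProductSpace

namespace Summit.AtomisticToContinuum.HydrodynamicLimit.Theorems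

open Literature.Analysis.FluidPDE Literature.MathematicalPhysics.KineticTheory

namespace KickFairRelEquilibriumFluxDisc

/-- `⟪-e₃, y⟫ = -y₂` in `ℝ³`. [folklore] -/
theorem inner_neg_single_two (y : V3) :
    ⟪(-EuclideanSpace.single (2 : Fin 3) (1 : ℝ) : V3), y⟫_ℝ = -(y 2) := by
  simp [inner_neg_left, EuclideanSpace.inner_single_left]

/-- Extensionality in `ℝ³` through the three coordinates. [folklore] -/
theorem ext_fin_three {x y : V3} (h0 : x 0 = y 0) (h1 : x 1 = y 1) (h2 : x 2 = y 2) : x = y := by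
  ext i
  fin_cases i
  exacts [h0, h1, h2]

/-- A unit vector `ν` of the open lower hemisphere is recovered from its transverse projection
`b = (ν₀, ν₁)`: `b` lies in the open unit disc and `(b₀, b₁, -√(1 - |b|²)) = ν`. [folklore] -/
theorem eq_of_lower_hemisphere {ν : V3} {b : EuclideanSpace ℝ (Fin 2)} (hν : ‖ν‖ = 1) (h2 : ν 2 < 0)
    (hb0 : b 0 = ν 0) (hb1 : b 1 = ν 1) :
    b ∈ Metric.ball (0 : EuclideanSpace ℝ (Fin 2)) 1 ∧
      (!₂[b 0, b 1, -Real.sqrt (1 - ‖b‖ ^ 2)] : V3) = ν := by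
  have hs : ‖b‖ ^ 2 = 1 - ν 2 ^ 2 := by
    have h3 : ‖ν‖ ^ 2 = ν 0 ^ 2 + ν 1 ^ 2 + ν 2 ^ 2 := by
      rw [EuclideanSpace.real_norm_sq_eq, Fin.sum_univ_three]
    rw [hν, one_pow] at h3
    rw [EuclideanSpace.real_norm_sq_eq, Fin.sum_univ_two, hb0, hb1]
    linarith
  refine ⟨?_, ?_⟩
  · rw [mem_ball_zero_iff]
    have h22 : 0 < ν 2 ^ 2 := by nlinarith
    exact (sq_lt_one_iff₀ (norm_nonneg _)).1 (by rw [hs]; linarith)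
  · have hsq : Real.sqrt (1 - ‖b‖ ^ 2) = -(ν 2) := by
      rw [hs, sub_sub_cancel, Real.sqrt_sq_eq_abs, abs_of_neg h2]
    rw [hsq, neg_neg, hb0, hb1]
    ext i
    fin_cases i <;> simp

/-- The flight-time integral of the slab indicator: for `-1 ≤ a`,
`∫⁻_{τ > 0} 1_{[-3,-2]}(a - τ) dτ = |[a + 2, a + 3]| = 1`. [folklore] -/
theorem lintegral_Ioi_indicator_slab {a : ℝ} (ha : -1 ≤ a) :
    ∫⁻ τ in Ioi (0 : ℝ), (Icc (-3 : ℝ) (-2)).indicator (fun _ => (1 : ℝ≥0∞)) (a - τ) = 1 := by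
  have h : ∀ τ : ℝ, (Icc (-3 : ℝ) (-2)).indicator (fun _ => (1 : ℝ≥0∞)) (a - τ) =
      (Icc (a + 2) (a + 3)).indicator (fun _ => (1 : ℝ≥0∞)) τ := by
    intro τ
    have hiff : a - τ ∈ Icc (-3 : ℝ) (-2) ↔ τ ∈ Icc (a + 2) (a + 3) := by
      simp only [mem_Icc]
      constructor <;> rintro ⟨h1, h2⟩ <;> constructor <;> linarith
    by_cases hτ : τ ∈ Icc (a + 2) (a + 3)
    · rw [indicator_of_mem hτ, indicator_of_mem (hiff.2 hτ)]
    · rw [indicator_of_notMem hτ, indicator_of_notMem (fun h' => hτ (hiff.1 h'))]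
  have hsub : Icc (a + 2) (a + 3) ⊆ Ioi 0 := fun τ hτ => lt_of_lt_of_le (by linarith : (0 : ℝ) < a + 2) hτ.1
  simp_rw [h]
  rw [lintegral_indicator measurableSet_Icc, setLIntegral_one, Measure.restrict_apply measurableSet_Icc,
    inter_eq_left.2 hsub, Real.volume_Icc, show a + 3 - (a + 2) = (1 : ℝ) by ring, ENNReal.ofReal_one]

/-- **Flux law on `S²`, lower-integral form**: for every measurable `F : ℝ³ → [0, ∞]`,
`∫⁻_{S²} F(ω) (-ω₂)₊ dσ(ω) = ∫⁻_{|b|<1} F(b₀, b₁, -√(1 - |b|²)) db` — the collision cylinder formula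
(CIP 1994 App. 4.A) with `ε = 1`, `u = -e₃`, tested against a unit slab in the flight time, and
Fubini in `ℝ³ ≅ ℝ × ℝ²`. [cite: CIP1994, App. 4.A p. 108] -/
theorem lintegral_flux_eq_lintegral_disc (F : V3 → ℝ≥0∞) (hF : Measurable F) :
    ∫⁻ ω : Metric.sphere (0 : V3) 1, F ω * ENNReal.ofReal (max (-((ω : V3) 2)) 0) ∂sphereMeasure =
      ∫⁻ b in Metric.ball (0 : EuclideanSpace ℝ (Fin 2)) 1,
        F !₂[b 0, b 1, -Real.sqrt (1 - ‖b‖ ^ 2)] := by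
  -- the data of the cylinder formula: `u = -e₃`, the test function `g`
  set u : V3 := -EuclideanSpace.single (2 : Fin 3) (1 : ℝ) with hu
  have hinner : ∀ y : V3, ⟪u, y⟫_ℝ = -(y 2) := fun y => by rw [hu]; exact inner_neg_single_two y
  have hu0 : u 0 = 0 := by rw [hu]; simp
  have hu1 : u 1 = 0 := by rw [hu]; simp
  have hu2 : u 2 = -1 := by rw [hu]; simp
  set K : EuclideanSpace ℝ (Fin 2) → ℝ≥0∞ := fun b =>
    (Metric.ball (0 : EuclideanSpace ℝ (Fin 2)) 1).indicator (fun _ => (1 : ℝ≥0∞)) b *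
      F !₂[b 0, b 1, -Real.sqrt (1 - ‖b‖ ^ 2)] with hK
  set g : V3 → ℝ≥0∞ := fun x =>
    (Icc (-3 : ℝ) (-2)).indicator (fun _ => (1 : ℝ≥0∞)) (x 2) *
      K !₂[x 0, x 1] with hg
  have hKm : Measurable K :=
    (measurable_const.indicator measurableSet_ball).mul (hF.comp (by fun_prop))
  have hgm : Measurable g :=
    ((measurable_const.indicator measurableSet_Icc).comp (by fun_prop : Measurable fun x : V3 => x 2)).mul
      (hKm.comp (by fun_prop))
  have hKb : ∀ b, K b = (Metric.ball (0 : EuclideanSpace ℝ (Fin 2)) 1).indicator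
      (fun b => F !₂[b 0, b 1, -Real.sqrt (1 - ‖b‖ ^ 2)]) b := by
    intro b
    by_cases hb : b ∈ Metric.ball (0 : EuclideanSpace ℝ (Fin 2)) 1
    · simp only [hK, indicator_of_mem hb, one_mul]
    · simp only [hK, indicator_of_notMem hb, zero_mul]
  -- (1) `g` is supported in the collision cylinder swept by the unit sphere moving along `e₃`
  have hsupp : Function.support g ⊆ collisionCylRegion 1 u := by
    intro x hx
    rw [Function.mem_support] at hx
    have hx2 : x 2 ∈ Icc (-3 : ℝ) (-2) := by
      by_contra h
      exact hx (by simp only [hg, indicator_of_notMem h, zero_mul])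
    have hxb : (!₂[x 0, x 1] : EuclideanSpace ℝ (Fin 2)) ∈ Metric.ball (0 : EuclideanSpace ℝ (Fin 2)) 1 := by
      by_contra h
      exact hx (by simp only [hg, hK, indicator_of_notMem h, zero_mul, mul_zero])
    have hs1 : x 0 ^ 2 + x 1 ^ 2 < 1 := by
      have hn : ‖(!₂[x 0, x 1] : EuclideanSpace ℝ (Fin 2))‖ < 1 := mem_ball_zero_iff.1 hxb
      have hb0 : (!₂[x 0, x 1] : EuclideanSpace ℝ (Fin 2)) 0 = x 0 := by simp
      have hb1 : (!₂[x 0, x 1] : EuclideanSpace ℝ (Fin 2)) 1 = x 1 := by simp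
      have h2 : ‖(!₂[x 0, x 1] : EuclideanSpace ℝ (Fin 2))‖ ^ 2 = x 0 ^ 2 + x 1 ^ 2 := by
        rw [EuclideanSpace.real_norm_sq_eq, Fin.sum_univ_two, hb0, hb1]
      nlinarith [norm_nonneg (!₂[x 0, x 1] : EuclideanSpace ℝ (Fin 2))]
    obtain ⟨r, hr⟩ : ∃ r : ℝ, r = Real.sqrt (1 - (x 0 ^ 2 + x 1 ^ 2)) := ⟨_, rfl⟩
    have hr0 : 0 < r := by rw [hr]; exact Real.sqrt_pos.2 (by linarith)
    have hr2 : r ^ 2 = 1 - (x 0 ^ 2 + x 1 ^ 2) := by rw [hr]; exact Real.sq_sqrt (by linarith)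
    have hr1 : r ≤ 1 := by
      rw [hr]; exact Real.sqrt_le_one.2 (by linarith [sq_nonneg (x 0), sq_nonneg (x 1)])
    set ν : V3 := !₂[x 0, x 1, -r] with hν
    have hn0 : ν 0 = x 0 := by simp [hν]
    have hn1 : ν 1 = x 1 := by simp [hν]
    have hn2 : ν 2 = -r := by simp [hν]
    have hν1 : ‖ν‖ = 1 := by
      have h : ‖ν‖ ^ 2 = 1 := by
        rw [EuclideanSpace.real_norm_sq_eq, Fin.sum_univ_three, hn0, hn1, hn2, neg_sq, hr2]; ring
      rw [← Real.sqrt_sq (norm_nonneg ν), h, Real.sqrt_one]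
    have hτ0 : 0 < -r - x 2 := by have := hx2.2; linarith
    refine ⟨(-r - x 2) • ν, (smul_mem_collisionCylDom_iff hτ0).2 ?_, ?_⟩
    · rw [mem_collisionCylDom, hinner, hn2, neg_neg]; exact hr0
    · rw [collisionCylMap_smul_unit 1 u hν1 hτ0, one_smul]
      refine ext_fin_three ?_ ?_ ?_
      · rw [PiLp.add_apply, PiLp.smul_apply, smul_eq_mul, hn0, hu0, mul_zero, add_zero]
      · rw [PiLp.add_apply, PiLp.smul_apply, smul_eq_mul, hn1, hu1, mul_zero, add_zero]
      · rw [PiLp.add_apply, PiLp.smul_apply, smul_eq_mul, hn2, hu2]; ring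
  -- (2) the bulk side: Fubini in `ℝ³ ≅ ℝ × ℝ²`
  have hL : ∫⁻ x in collisionCylRegion 1 u, g x ∂volume =
      ∫⁻ b in Metric.ball (0 : EuclideanSpace ℝ (Fin 2)) 1, F !₂[b 0, b 1, -Real.sqrt (1 - ‖b‖ ^ 2)] := by
    rw [setLIntegral_eq_of_support_subset hsupp]
    have hφ : MeasurePreserving
        (fun x : V3 => (MeasurableEquiv.piFinSuccAbove (fun _ : Fin 3 => ℝ) 2) (WithLp.ofLp x)) volume volume :=
      (volume_preserving_piFinSuccAbove (fun _ : Fin 3 => ℝ) 2).comp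
        (EuclideanSpace.volume_preserving_symm_measurableEquiv_toLp (Fin 3))
    set H : ℝ × (Fin 2 → ℝ) → ℝ≥0∞ := fun p =>
      (Icc (-3 : ℝ) (-2)).indicator (fun _ => (1 : ℝ≥0∞)) p.1 * K (WithLp.toLp 2 p.2) with hH
    have hHm : Measurable H :=
      ((measurable_const.indicator measurableSet_Icc).comp measurable_fst).mul
        (hKm.comp ((WithLp.measurable_toLp 2 (Fin 2 → ℝ)).comp measurable_snd))
    have hgH : ∀ x : V3, g x = H ((MeasurableEquiv.piFinSuccAbove (fun _ : Fin 3 => ℝ) 2) (WithLp.ofLp x)) := by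
      intro x
      have h1 : ((MeasurableEquiv.piFinSuccAbove (fun _ : Fin 3 => ℝ) 2) (WithLp.ofLp x)).1 = x 2 := rfl
      have h2 : ((MeasurableEquiv.piFinSuccAbove (fun _ : Fin 3 => ℝ) 2) (WithLp.ofLp x)).2 = ![x 0, x 1] := by
        funext j; fin_cases j <;> rfl
      simp only [hg, hH, h1, h2]
    calc ∫⁻ x, g x ∂volume
        = ∫⁻ x, H ((MeasurableEquiv.piFinSuccAbove (fun _ : Fin 3 => ℝ) 2) (WithLp.ofLp x)) ∂volume :=
          lintegral_congr fun x => hgH x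
      _ = ∫⁻ p, H p ∂volume := hφ.lintegral_comp hHm
      _ = (∫⁻ t, (Icc (-3 : ℝ) (-2)).indicator (fun _ => (1 : ℝ≥0∞)) t ∂volume) *
            ∫⁻ c : Fin 2 → ℝ, K (WithLp.toLp 2 c) ∂volume := by
          rw [hH]
          exact lintegral_prod_mul (f := fun t : ℝ => (Icc (-3 : ℝ) (-2)).indicator (fun _ => (1 : ℝ≥0∞)) t)
            (g := fun c : Fin 2 → ℝ => K (WithLp.toLp 2 c))
            (measurable_const.indicator measurableSet_Icc).aemeasurable
            (hKm.comp (WithLp.measurable_toLp 2 (Fin 2 → ℝ))).aemeasurable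
      _ = ∫⁻ b, K b ∂volume := by
          rw [lintegral_indicator measurableSet_Icc, setLIntegral_one, Real.volume_Icc,
            (PiLp.volume_preserving_toLp (Fin 2)).lintegral_comp hKm]
          norm_num
      _ = ∫⁻ b in Metric.ball (0 : EuclideanSpace ℝ (Fin 2)) 1, F !₂[b 0, b 1, -Real.sqrt (1 - ‖b‖ ^ 2)] := by
          simp_rw [hKb]
          rw [lintegral_indicator measurableSet_ball]
  -- (3) the sphere side: the flight-time integral is `1` and `ω(π(ν - τ e₃)) = ν`
  have hR : ∀ ν : Metric.sphere (0 : V3) 1,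
      ∫⁻ τ in Ioi (0 : ℝ), (collisionCylDom u).indicator (fun _ => (1 : ℝ≥0∞)) (ν : V3) *
          (ENNReal.ofReal ((1 : ℝ) ^ (Module.finrank ℝ V3 - 1) * ⟪u, (ν : V3)⟫_ℝ) *
            g ((1 : ℝ) • (ν : V3) + τ • u)) ∂volume =
        F ν * ENNReal.ofReal (max (-((ν : V3) 2)) 0) := by
    intro ν
    have hν : ‖(ν : V3)‖ = 1 := by simp
    have hν2 : -1 ≤ (ν : V3) 2 := by
      have h := PiLp.norm_apply_le (ν : V3) 2
      rw [hν, Real.norm_eq_abs] at h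
      linarith [neg_abs_le ((ν : V3) 2)]
    simp only [one_pow, one_mul, one_smul, hinner]
    by_cases hlt : (ν : V3) 2 < 0
    · have hmem : (ν : V3) ∈ collisionCylDom u := by rw [mem_collisionCylDom, hinner]; linarith
      obtain ⟨hball, heq⟩ := eq_of_lower_hemisphere (b := !₂[(ν : V3) 0, (ν : V3) 1]) hν hlt (by simp) (by simp)
      have hgν : ∀ τ : ℝ, g ((ν : V3) + τ • u) =
          (Icc (-3 : ℝ) (-2)).indicator (fun _ => (1 : ℝ≥0∞)) ((ν : V3) 2 - τ) * F ν := by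
        intro τ
        have h0 : ((ν : V3) + τ • u) 0 = (ν : V3) 0 := by
          simp only [PiLp.add_apply, PiLp.smul_apply, smul_eq_mul, hu0, mul_zero, add_zero]
        have h1 : ((ν : V3) + τ • u) 1 = (ν : V3) 1 := by
          simp only [PiLp.add_apply, PiLp.smul_apply, smul_eq_mul, hu1, mul_zero, add_zero]
        have h2 : ((ν : V3) + τ • u) 2 = (ν : V3) 2 - τ := by
          simp only [PiLp.add_apply, PiLp.smul_apply, smul_eq_mul, hu2]; ring
        simp only [hg, hK, h0, h1, h2, indicator_of_mem hball, one_mul, heq]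
      have hmeas : Measurable fun τ : ℝ =>
          (Icc (-3 : ℝ) (-2)).indicator (fun _ => (1 : ℝ≥0∞)) ((ν : V3) 2 - τ) :=
        (measurable_const.indicator measurableSet_Icc).comp (by fun_prop)
      have hcomm : ∀ τ : ℝ, ENNReal.ofReal (-((ν : V3) 2)) *
          ((Icc (-3 : ℝ) (-2)).indicator (fun _ => (1 : ℝ≥0∞)) ((ν : V3) 2 - τ) * F ν) =
            (ENNReal.ofReal (-((ν : V3) 2)) * F ν) *
              (Icc (-3 : ℝ) (-2)).indicator (fun _ => (1 : ℝ≥0∞)) ((ν : V3) 2 - τ) := fun τ => by ring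
      simp_rw [indicator_of_mem hmem, one_mul, hgν, hcomm]
      rw [lintegral_const_mul _ hmeas, lintegral_Ioi_indicator_slab hν2, mul_one, mul_comm,
        max_eq_left (by linarith)]
    · have hnot : (ν : V3) ∉ collisionCylDom u := by rw [mem_collisionCylDom, hinner]; linarith
      simp only [indicator_of_notMem hnot, zero_mul, lintegral_zero]
      rw [max_eq_right (by linarith), ENNReal.ofReal_zero, mul_zero]
  -- conclusion
  have key := lintegral_collisionCylinder (volume : Measure V3) one_pos u g hgm
  rw [hL] at key
  rw [key]
  unfold sphereMeasure
  exact lintegral_congr fun ν => (hR ν).symm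

end KickFairRelEquilibriumFluxDisc

open KickFairRelEquilibriumFluxDisc in
/-- **Flux law on `S²` from a uniform impact parameter on the disc** (line `Sketch`, lemma L1; CIP
1994 App. 4.A): for every bounded measurable `G : ℝ³ → ℝ`,
`∫_{S²} G(ω) (-ω₂)₊ dσ(ω) = ∫_{|b|<1} G(b₀, b₁, -√(1 - |b|²)) db` — if the impact parameter is
Lebesgue-uniform on the unit disc transverse to `e₃`, the (incoming, lower-hemisphere) contact
vector has law `(-ω₂)₊ dσ`; equivalently `dσ = db / |ω₂|` on the lower hemisphere.
[cite: CIP1994, App. 4.A p. 108] -/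
theorem integral_flux_eq_integral_disc :
    ∀ G : V3 → ℝ, Measurable G → (∃ C : ℝ, ∀ x, |G x| ≤ C) →
      ∫ ω : Metric.sphere (0 : V3) 1, G ω * max (-((ω : V3) 2)) 0 ∂sphereMeasure =
        ∫ b in Metric.ball (0 : EuclideanSpace ℝ (Fin 2)) 1,
          G !₂[b 0, b 1, -Real.sqrt (1 - ‖b‖ ^ 2)] := by
  intro G hG hC
  obtain ⟨C, hC⟩ := hC
  haveI : IsFiniteMeasure (sphereMeasure (E := V3)) := by unfold sphereMeasure; infer_instance
  have hm0 : ∀ ω : Metric.sphere (0 : V3) 1, 0 ≤ max (-((ω : V3) 2)) 0 := fun ω => le_max_right _ _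
  have hm1 : ∀ ω : Metric.sphere (0 : V3) 1, max (-((ω : V3) 2)) 0 ≤ 1 := by
    intro ω
    refine max_le ?_ zero_le_one
    have h := PiLp.norm_apply_le (ω : V3) 2
    have hn : ‖(ω : V3)‖ = 1 := by simp
    rw [hn, Real.norm_eq_abs] at h
    linarith [le_abs_self ((ω : V3) 2), neg_le_abs ((ω : V3) 2)]
  -- integrability of both sides (bounded measurable functions on finite measures)
  have hint1 : Integrable (fun ω : Metric.sphere (0 : V3) 1 => G ω * max (-((ω : V3) 2)) 0) sphereMeasure := by
    refine Integrable.of_bound ?_ C (Eventually.of_forall fun ω => ?_)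
    · exact ((hG.comp continuous_subtype_val.measurable).mul
        (by fun_prop : Continuous fun ω : Metric.sphere (0 : V3) 1 =>
          max (-((ω : V3) 2)) 0).measurable).aestronglyMeasurable
    · rw [Real.norm_eq_abs, abs_mul, abs_of_nonneg (hm0 ω)]
      exact (mul_le_of_le_one_right (abs_nonneg _) (hm1 ω)).trans (hC _)
  have hωm : Measurable fun b : EuclideanSpace ℝ (Fin 2) =>
      (!₂[b 0, b 1, -Real.sqrt (1 - ‖b‖ ^ 2)] : V3) := by
    fun_prop
  have hint2 : Integrable (fun b : EuclideanSpace ℝ (Fin 2) => G !₂[b 0, b 1, -Real.sqrt (1 - ‖b‖ ^ 2)])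
      (volume.restrict (Metric.ball (0 : EuclideanSpace ℝ (Fin 2)) 1)) := by
    refine Measure.integrableOn_of_bounded (M := C) measure_ball_lt_top.ne
      (hG.comp hωm).aestronglyMeasurable (Eventually.of_forall fun b => ?_)
    rw [Real.norm_eq_abs]
    exact hC _
  rw [integral_eq_lintegral_pos_part_sub_lintegral_neg_part hint1,
    integral_eq_lintegral_pos_part_sub_lintegral_neg_part hint2]
  have e1 : ∫⁻ ω, ENNReal.ofReal (G ω * max (-((ω : V3) 2)) 0) ∂sphereMeasure =
      ∫⁻ ω : Metric.sphere (0 : V3) 1,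
        ENNReal.ofReal (G ω) * ENNReal.ofReal (max (-((ω : V3) 2)) 0) ∂sphereMeasure :=
    lintegral_congr fun ω => ENNReal.ofReal_mul' (hm0 ω)
  have e2 : ∫⁻ ω, ENNReal.ofReal (-(G ω * max (-((ω : V3) 2)) 0)) ∂sphereMeasure =
      ∫⁻ ω : Metric.sphere (0 : V3) 1,
        ENNReal.ofReal (-G ω) * ENNReal.ofReal (max (-((ω : V3) 2)) 0) ∂sphereMeasure :=
    lintegral_congr fun ω => by rw [← neg_mul, ENNReal.ofReal_mul' (hm0 ω)]
  have h1 := lintegral_flux_eq_lintegral_disc (fun x => ENNReal.ofReal (G x)) hG.ennreal_ofReal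
  have h2 := lintegral_flux_eq_lintegral_disc (fun x => ENNReal.ofReal (-G x)) hG.neg.ennreal_ofReal
  rw [e1, e2, h1, h2]

end Summit.AtomisticToContinuum.HydrodynamicLimit.Theorems

end
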